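import Literature.Computability.Complexity.PromiseCookReductions
import Literature.Computability.Complexity.TruthTableClosure
import HarnessLib

/-!
# Nonadaptive (truth-table) Cook reductions between promise problems

Trunk `Computability/Complexity`, companion of `PromiseCookReductions.lean` (Goldreich's Cook
reductions of promise problems, Def. 3: the reduction must be correct for EVERY oracle solving the
target problem, whatever it answers — `1`, `0` or `⊥` — off the promise) and of
`TruthTableClosure.lean` (truth-table oracle machines `ttAlg` against LANGUAGE oracles).

A **polynomial-time truth-table (nonadaptive) reduction** of a promise problem `Q₁` to a promise
problem `Q₂` [Ladner–Lynch–Selman 1975, §3; Goldreich 2006, §1.2 Def. 3] is given by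

* a query generator `Q ∈ FP`: the `i`-th query on input `x` is `Q ⟨x, 1ⁱ⟩`;
* a polynomial `q`: the queries asked are those with `i < q(|x|)`;
* an evaluator `D ∈ P` reading the input TOGETHER WITH THE CODED LIST OF ANSWERS
  `⟨x, listBool [a₀, …, a_{q(|x|)-1}]⟩`, `aᵢ = O (Q ⟨x, 1ⁱ⟩) ∈ {[1], [0], []}` (a promise oracle may
  answer `⊥ = []` off the promise, so — unlike `ttAlg`, whose evaluator reads the flattened answer
  bits of a language oracle — the answers are handed over as a coded list, each in its slot).

Main results:

* `ttAlgP Q q D` — the oracle algorithm (transcript model of `Oracle.lean`) asking the `q(|x|)`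
  queries in order and then deciding by `D` on the coded transcript; `isPolyTime_ttAlgP` — its step
  function is polynomial-time (`condFn` of the length guard `GoOn q`, the query writer `qryS Q` of
  `TruthTableClosure.lean`, and the verdict `1 · [w ∈ D]` on the raw step input `w`);
  `trans_ttAlgP` / `run_ttAlgP` / `exists_of_mem_queries_ttAlgP` — against ANY oracle `O` it
  receives the answers `ttAnswers Q O x i`, outputs `[⟨x, code (ttAnswers Q O x (q |x|))⟩ ∈ D]`
  within `q(|x|) + 1` rounds, and asks only the intended queries;
* **`PromiseProblem.cookReducible_of_truthTable`**: if for every oracle `O` solving `Q₂`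
  (`SolvedBy`) the verdict is `true` on `Q₁.yes` and `false` on `Q₁.no`, then
  `Q₁.CookReducible Q₂` (Goldreich's Def. 3, with round/query budget `ttBudget q s` for an
  output-length polynomial `s` of `Q`).

## References

* R. E. Ladner, N. A. Lynch, A. L. Selman, *A comparison of polynomial time reducibilities*,
  Theoret. Comput. Sci. 1 (1975) 103–123, §3 (`≤ᵖₜₜ`; `≤ᵖₜₜ ⇒ ≤ᵖ_T`).
* O. Goldreich, *On promise problems: a survey*, LNCS 3895 (2006) 254–290, §1.2, Def. 3 and the
  remark following it (reductions to promise problems must tolerate arbitrary answers off the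
  promise).
* S. Arora, B. Barak, *Computational Complexity: A Modern Approach*, CUP 2009, §3.4.
-/

namespace Literature.Computability.Complexity

open _root_.Computability Polynomial PRelSigma OracleCompose TTClosure

section TT

section Defs

variable (Q : List Bool → List Bool) (q : Polynomial ℕ) (D : Language Bool)

/-- The answers of the oracle `O` to the first `n` nonadaptive queries `Q ⟨x, 1⁰⟩, …, Q ⟨x, 1ⁿ⁻¹⟩`
(arbitrary strings; for an oracle solving a promise problem each is `[1]`, `[0]` or `[] = ⊥`).
[cite: LadnerLynchSelman1975, §3] -/
def ttAnswers (O : Oracle) (x : List Bool) (n : ℕ) : List (List Bool) :=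
  (List.range n).map fun i => O (Q (boolPair x (List.replicate i true)))

/-- **The truth-table oracle algorithm for promise oracles**: while fewer than `q(|x|)` answers have
been received, ask `Q ⟨x, 1^{#answers}⟩`; then output `[⟨x, listBool answers⟩ ∈ D]` (the evaluator
reads the coded transcript, so that `⊥`-answers keep their slots). [cite: Goldreich2006, §1.2 Def. 3] -/
noncomputable def ttAlgP : OracleAlg Bool where
  step x ans :=
    if ans.length < q.eval x.length then Sum.inl (Q (boolPair x (List.replicate ans.length true)))
    else Sum.inr (D.boolIndicator (boolPair x ((encodingList Bool).listBool.encode ans)))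

/-- The code `1 · [w ∈ D]` of the verdict, on the raw step input `w = ⟨x, listBool answers⟩`.
[folklore] -/
noncomputable def decP : List Bool → List Bool :=
  List.cons true ∘ fun w => encodeBool (D.boolIndicator w)

/-- **The step function of `ttAlgP` as a string map.** [folklore] -/
noncomputable def stepP : List Bool → List Bool := condFn (GoOn q) (qryS Q) (decP D)

end Defs

variable {Q : List Bool → List Bool} {q : Polynomial ℕ} {D : Language Bool}

/-- `ttAnswers` has `n` entries. [folklore] -/
@[simp] theorem length_ttAnswers (O : Oracle) (x : List Bool) (n : ℕ) :
    (ttAnswers Q O x n).length = n := by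
  simp [ttAnswers]

/-- One more answer. [folklore] -/
theorem ttAnswers_succ (O : Oracle) (x : List Bool) (n : ℕ) :
    ttAnswers Q O x (n + 1) = ttAnswers Q O x n ++ [O (Q (boolPair x (List.replicate n true)))] := by
  simp [ttAnswers, List.range_succ]

/-- The `i`-th answer (default form). [folklore] -/
theorem getD_ttAnswers (O : Oracle) (x : List Bool) {n i : ℕ} (hi : i < n) (d : List Bool) :
    (ttAnswers Q O x n).getD i d = O (Q (boolPair x (List.replicate i true))) := by
  rw [List.getD_eq_getElem _ _ (by simpa using hi)]
  simp [ttAnswers, List.getElem_range]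

/-- The step of `ttAlgP` before the last query has been answered is the next query. [folklore] -/
theorem ttAlgP_step_of_lt (x : List Bool) {ans : List (List Bool)} (h : ans.length < q.eval x.length) :
    (ttAlgP Q q D).step x ans = Sum.inl (Q (boolPair x (List.replicate ans.length true))) := by
  simp [ttAlgP, h]

/-- The step of `ttAlgP` after all answers is the verdict on the coded transcript. [folklore] -/
theorem ttAlgP_step_of_le (x : List Bool) {ans : List (List Bool)} (h : q.eval x.length ≤ ans.length) :
    (ttAlgP Q q D).step x ans =
      Sum.inr (D.boolIndicator (boolPair x ((encodingList Bool).listBool.encode ans))) := by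
  simp [ttAlgP, Nat.not_lt.2 h]

/-- **The transcript of `ttAlgP` against any oracle is the list of its answers to the intended
queries.** [folklore] -/
theorem trans_ttAlgP (O : Oracle) (x : List Bool) :
    ∀ i ≤ q.eval x.length, trans (ttAlgP Q q D) O x i = ttAnswers Q O x i
  | 0, _ => by simp [ttAnswers]
  | i + 1, hi => by
    have ih := trans_ttAlgP O x i (Nat.le_of_succ_le hi)
    rw [trans_succ, ih, qryOf_eq_of_step_eq (ttAlgP_step_of_lt x (by simpa using hi)),
      ttAnswers_succ, length_ttAnswers]

/-- **`ttAlgP` outputs the verdict on the coded answers** within any budget of more than `q(|x|)`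
rounds, against any oracle. [cite: LadnerLynchSelman1975, §3] -/
theorem run_ttAlgP (O : Oracle) (x : List Bool) {n : ℕ} (hn : q.eval x.length < n) :
    (ttAlgP Q q D).run O n x =
      some (D.boolIndicator (boolPair x
        ((encodingList Bool).listBool.encode (ttAnswers Q O x (q.eval x.length))))) := by
  rw [run_eq_some_iff]
  refine ⟨q.eval x.length, hn, fun i hi => ⟨Q (boolPair x (List.replicate i true)), ?_⟩, ?_⟩
  · rw [trans_ttAlgP O x i hi.le, ttAlgP_step_of_lt x (by simpa using hi), length_ttAnswers]
  · rw [trans_ttAlgP O x _ le_rfl, ttAlgP_step_of_le x (by simp)]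

/-- **The queries of `ttAlgP` are the intended ones**: every recorded query is `Q ⟨x, 1ⁱ⟩` for some
`i < q(|x|)`, against any oracle. [folklore] -/
theorem exists_of_mem_queries_ttAlgP (O : Oracle) (x : List Bool) {n : ℕ} {y : List Bool}
    (hy : y ∈ (ttAlgP Q q D).queries O n x) :
    ∃ i < q.eval x.length, y = Q (boolPair x (List.replicate i true)) := by
  obtain ⟨i, -, hall, rfl⟩ := exists_of_mem_queries _ _ n x y hy
  have hi : i < q.eval x.length := by
    by_contra hle
    obtain ⟨y', hy'⟩ := hall (q.eval x.length) (Nat.not_lt.1 hle)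
    rw [trans_ttAlgP O x _ le_rfl, ttAlgP_step_of_le x (by simp)] at hy'
    cases hy'
  refine ⟨i, hi, ?_⟩
  rw [trans_ttAlgP O x i hi.le, qryOf_eq_of_step_eq (ttAlgP_step_of_lt x (by simpa using hi)),
    length_ttAnswers]

/-! ### The step function of `ttAlgP` as a string map -/

/-- `decP D ∈ FP` for `D ∈ P`. [folklore] -/
theorem decP_mem_FP (hD : D ∈ Classes.P) : decP D ∈ FP :=
  comp_mem_FP (cons_mem_FP true) (indicatorFn_mem_FP hD)

/-- **`stepP ∈ FP`.** [folklore] -/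
theorem stepP_mem_FP (hQ : Q ∈ FP) (hD : D ∈ Classes.P) : stepP Q q D ∈ FP :=
  condFn_mem_FP (GoOn_mem_P q) (qryS_mem_FP hQ) (decP_mem_FP hD)

/-- The verdict branch computes the verdict code. [folklore] -/
theorem decP_apply (w : List Bool) : decP D w = [true, D.boolIndicator w] := rfl

/-- **The string map computes the step function.** [folklore] -/
theorem stepP_apply (x : List Bool) (ans : List (List Bool)) :
    stepP Q q D (boolPair x ((encodingList Bool).listBool.encode ans)) =
      stepCode ((ttAlgP Q q D).step x ans) := by
  by_cases h : ans.length < q.eval x.length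
  · rw [stepP, condFn_of_mem _ _ ((mem_GoOn_iff x ans).2 h), ttAlgP_step_of_lt x h, qryS_apply,
      stepCode_inl]
  · rw [stepP, condFn_of_not_mem _ _ (fun h' => h ((mem_GoOn_iff x ans).1 h')),
      ttAlgP_step_of_le x (Nat.not_lt.1 h), decP_apply, stepCode_inr]

/-- **`ttAlgP` is polynomial-time** for `Q ∈ FP` and `D ∈ P`. [cite: LadnerLynchSelman1975, §3] -/
theorem isPolyTime_ttAlgP (hQ : Q ∈ FP) (hD : D ∈ Classes.P) :
    (ttAlgP Q q D).IsPolyTime encodingBoolBool := by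
  obtain ⟨p, Mx, h⟩ := stepP_mem_FP (q := q) hQ hD
  refine ⟨p, Mx, fun z => ?_⟩
  have hz := h (boolPair z.1 ((encodingList Bool).listBool.encode z.2))
  rw [id, stepP_apply] at hz
  exact hz

end TT

/-! ### Main result: truth-table reductions of promise problems are Cook reductions -/

/-- **A polynomial-time truth-table reduction between promise problems is a Cook reduction**
(Goldreich 2006, Def. 3): given a query generator `Q ∈ FP`, a polynomial `q` and an evaluator
`D ∈ P` such that, for EVERY oracle `O` solving `Q₂` (correct on the promise of `Q₂`, arbitrary
`1/0/⊥` elsewhere), `⟨x, listBool (answers of O to Q ⟨x,1ⁱ⟩, i < q |x|)⟩` lies in `D` for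
`x ∈ Q₁.yes` and outside `D` for `x ∈ Q₁.no`, the problem `Q₁` Cook-reduces to `Q₂` — by the
oracle algorithm `ttAlgP Q q D`, within `ttBudget q s` rounds and query length, `s` an output-length
polynomial of `Q`. [cite: Goldreich2006, §1.2 Def. 3] -/
theorem PromiseProblem.cookReducible_of_truthTable {Q₁ Q₂ : PromiseProblem}
    {Q : List Bool → List Bool} (hQ : Q ∈ FP) (q : Polynomial ℕ) {D : Language Bool}
    (hD : D ∈ Classes.P)
    (h : ∀ O : Oracle, Q₂.SolvedBy O → ∀ x : List Bool,
      (x ∈ Q₁.yes → boolPair x ((encodingList Bool).listBool.encode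
          (ttAnswers Q O x (q.eval x.length))) ∈ D) ∧
      (x ∈ Q₁.no → boolPair x ((encodingList Bool).listBool.encode
          (ttAnswers Q O x (q.eval x.length))) ∉ D)) :
    Q₁.CookReducible Q₂ := by
  obtain ⟨s, hs⟩ := exists_poly_length_le_of_mem_FP hQ
  refine ⟨ttAlgP Q q D, isPolyTime_ttAlgP hQ hD, ttBudget q s, fun O hO x => ?_⟩
  have hrun := run_ttAlgP (Q := Q) (q := q) (D := D) O x (n := (ttBudget q s).eval x.length)
    (by rw [ttBudget_eval]; omega)
  have hqry : ∀ y ∈ (ttAlgP Q q D).queries O ((ttBudget q s).eval x.length) x,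
      y.length ≤ (ttBudget q s).eval x.length := by
    intro y hy
    obtain ⟨i, hi, rfl⟩ := exists_of_mem_queries_ttAlgP (Q := Q) (q := q) (D := D) O x hy
    refine (hs _).trans ?_
    rw [ttBudget_eval, length_boolPair, List.length_replicate]
    exact (TM2Iter.eval_mono s (by omega)).trans (Nat.le_add_left _ _)
  refine ⟨fun hx => ⟨?_, hqry⟩, fun hx => ⟨?_, hqry⟩⟩
  · rw [hrun, (Set.mem_iff_boolIndicator _ _).1 ((h O hO x).1 hx)]
  · rw [hrun, (Set.notMem_iff_boolIndicator _ _).1 ((h O hO x).2 hx)]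

end Literature.Computability.Complexity
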